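import Mathlib
import Summits.CriticalPhenomena.CardyFormulaZ2.Theses.CardyMagicRigidity
import Summits.CriticalPhenomena.CardyFormulaZ2.Theorems.CardyMagicRigidityHexSegmentDefs
import Summits.CriticalPhenomena.CardyFormulaZ2.Theorems.CardyMagicRigidityLoopLimitZ2EqTCoinMeasurable
import Summits.CriticalPhenomena.CardyFormulaZ2.Theorems.CardyMagicRigidityLoopLimitZ2EqTBondEnd
import Summits.CriticalPhenomena.CardyFormulaZ2.Theorems.CardyMagicRigidityLoopLimitZ2EqTFlatOfSymmetry
import Summits.CriticalPhenomena.CardyFormulaZ2.Theorems.CardyMagicRigidityLoopLimitZ2EqTSiteEnd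
import Summits.CriticalPhenomena.CardyFormulaZ2.Theorems.CardyMagicRigidityLoopLimitZ2EqTChainGlue
import Summits.CriticalPhenomena.CardyFormulaZ2.Theorems.CardyMagicRigidityLoopLimitZ2EqTRussoMixture
import Summits.CriticalPhenomena.CardyFormulaZ2.Theorems.CardyMagicRigidityLoopLimitZ2EqTSiteEndCrossings
import Summits.CriticalPhenomena.CardyFormulaZ2.Theorems.CardyMagicRigidityLoopLimitZ2EqTConditional
import Literature.Probability.Percolation.FullPlaneCNL
import Literature.Probability.RandomPlanarGeometry.LoopConfigurationsMetric
import HarnessLib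

/-!
# Line `Sketch` (card `hex-segment-odd-channel`) — skeleton r7 for crux `LoopLimitZ2EqT`
# (stmt-CriticalPhenomena-4833), route `CardyMagicRigidity`, sub-problem `CriticalPhenomena/CardyFormulaZ2`

The crux, by name: `Summit.CriticalPhenomena.CardyFormulaZ2.Theses.CardyMagicRigidity.LoopLimitZ2EqT`
≡ `d_CN((P^bond_{1/2}, bondLoopConfig δ 0), (P^site_{1/2}, siteLoopConfig δ)) → 0` as `δ → 0⁺`.

THE LINE (two-leg Chayes–Lei chain at loop level; vocabulary AND all stub statements in the LANDED
definitions module `Theorems/CardyMagicRigidityHexSegmentDefs.lean`, §1 (p86310) and §3 (p123191)):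

  bond-`ℤ²`_δ ~[S4 `TriToSquareLoops`]~ bond-`𝕋̃`_δ =[S1 `BondEndLaw`]= M₁ ~[S5 ⇒ S6 ⇒ S7]~ M₀ ~[S2 `SiteEndLoops`]~ site-`𝕋`_δ

Status r7 (continuation lead c1, prover-line-stmt-CriticalPhenomena-4833-c1-0, 2026-08-16T20:3xZ).
LANDED and imported (no sorry): S1 `stub_bondEnd` (p89250), S2 `stub_siteEnd` (p95819 + 13 helper
files), S3 `stub_coinMeasurable` (p87343), S5a `stub_russoMixture` (p96401), S6 `stub_flatOfSymmetry`
(p90168), S7a `stub_siteEndCrossings` (p103501 + p100077 p100078 p100079 p101368), the chain glue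
`loopLimitZ2EqT_of_stubs` (p93819), and NEW the whole remaining composition as the conditional closing
theorem `loopLimitZ2EqT_of_residuals : TriToSquareLoops → InfluenceVanishes → CardyToCLE → LoopLimitZ2EqT`
(`Theorems/CardyMagicRigidityLoopLimitZ2EqTConditional.lean`, p123663; also
`loopLimitZ2EqT_of_bondEndLoops : TriToSquareLoops → BondEndLoops → LoopLimitZ2EqT` — the crux factors
through the two loop-level universality statements "bond-ℤ² ~ bond-𝕋̃" and "bond-𝕋̃ ~ site-𝕋" — and
`bondEndCrossings_of_influenceVanishes : InfluenceVanishes → BondEndCrossings`, S5b ⇒ Cardy for critical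
bond-𝕋̃ at crossing level, cf. the crux `CardyBondTriangular.BondTriangularCardy` = stmt-4664 of the
sibling route, same statement up to the embedding normalisation of `embDomainCrossing`).
So this file is now three sorried stubs and ONE line of glue. OPEN — the only sorries, none
worker-sized, none refuted (Disproof.lean rev 3 has no `-- Targets` on them; two stub-workers
2026-08-16T20:0xZ: `stub-blocked: none in tree` for S4 and S5b, S5b verified well-posed as typed):
* S4 `stub_triToSquareLoops : TriToSquareLoops` — the `(ℤ², 𝕋̃)`, `q = 1` instance of the announced,
  UNPUBLISHED 3-direction isoradial `d_CN`-universality [HM24] (Manolescu arXiv:2502.08394 Rem 5.6);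
  tree shadows `dkkmo_theorem_1_7`, `dkkmo_universality_coupling`, `dkkmo_theorem_1_2` are 2-direction;
* S5b `stub_influenceVanishes : InfluenceVanishes` — THE research content: universality of crossing
  probabilities along the Chayes–Lei self-dual hexagon family `s = t·p_c(1−p_c)² ∈ [0, 0.148]`
  (colour-odd five-arm coupling `k₅^odd ≡ 0`), open since Chayes–Lei 2007; MC consistent with 0
  (kit j014258, j016193, j017798: |E_t[D]| ≲ 0.015 at H = 256, decaying in H);
* S7c `stub_cardyToCLE : CardyToCLE` (`BondEndCrossings → BondEndLoops`) — the Camia–Newman CLE₆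
  pipeline for critical bond-`𝕋̃` given Cardy, relative to site-`𝕋`; crux-sized (the site-`𝕋`
  original is itself only the named facts `exists_isFullPlaneCNLLaw` /
  `convergesInLawToSLE_six_triInterface` in the tree; no published source treats `𝕋̃`).
-/

noncomputable section

open MeasureTheory Set Filter Metric
open scoped Real Topology ENNReal BigOperators

namespace Summit.CriticalPhenomena.CardyFormulaZ2.Cruxes.LoopLimitZ2EqT.HexSegment

open Literature.Probability.RandomPlanarGeometry Literature.Probability.Percolation
  Literature.Probability.LatticeModels
open _root_.Summit.CriticalPhenomena.CardyFormulaZ2.Theses.CardyMagicRigidity (LoopLimitZ2EqT)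

/-! ## §1 Landed stubs and glue (imported, sorry-free) -/

example : BondEndLaw := stub_bondEnd
example : SiteEndLoops := stub_siteEnd
example : CoinMeasurable := stub_coinMeasurable
example : UniformAttachmentSymmetry → HexSegmentFlat := stub_flatOfSymmetry
example := stub_russoMixture
example : ∀ R : ConformalRectangle, R.HasCrossingLimit (segCross 0 R)
    Literature.Probability.RandomPlanarGeometry.cardyFunction := stub_siteEndCrossings
example : BondEndLaw → SiteEndLoops → CoinMeasurable → TriToSquareLoops → SegmentLoops → LoopLimitZ2EqT :=
  loopLimitZ2EqT_of_stubs
example : InfluenceVanishes → UniformAttachmentSymmetry := uniformAttachmentSymmetry_of_influenceVanishes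
example : HexSegmentFlat → BondEndCrossings := bondEndCrossings_of_hexSegmentFlat
example : InfluenceVanishes → BondEndCrossings := bondEndCrossings_of_influenceVanishes
example : BondEndLoops → SegmentLoops := segmentLoops_of_bondEndLoops
example : TriToSquareLoops → BondEndLoops → LoopLimitZ2EqT := loopLimitZ2EqT_of_bondEndLoops
example : TriToSquareLoops → InfluenceVanishes → CardyToCLE → LoopLimitZ2EqT := loopLimitZ2EqT_of_residuals

/-! ## §2 Registered stubs still open (the only sorries) -/

/-- S4 **Isoradial transport bond-`ℤ²` ~ bond-`𝕋̃` at loop level** (literature-grade input [HM24],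
unpublished; conjecture-grade until released): `TriToSquareLoops`. -/
theorem stub_triToSquareLoops : TriToSquareLoops := by
  sorry

/-- S5b **The total type influence vanishes uniformly** (THE research content of the line, sharp
form; Defs §3 `InfluenceVanishes`): for every conformal rectangle `R` and `ε > 0`, once
`δ < δ₀(ε, R)`, the total type influence of the segment model on the crude crossing event is `< ε`
in absolute value for EVERY `t ∈ [0,1]` — the colour-odd five-arm coupling `k₅^odd(t) ≡ 0`. -/
theorem stub_influenceVanishes : InfluenceVanishes := by
  sorry

/-- S7c **Cardy ⇒ CLE₆ for `M₁`, relative form** (Defs §3 `CardyToCLE := BondEndCrossings →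
BondEndLoops`; XL, the research-grade TECHNOLOGY stub: Camia–Newman's full-plane theorem re-run for
critical bond percolation on `𝕋̃`, stated relative to site-`𝕋`). -/
theorem stub_cardyToCLE : CardyToCLE := by
  sorry

/-! ## §3 Composition (landed glue, one line) -/

/-- **The two-leg Chayes–Lei chain closes `LoopLimitZ2EqT`** — concludes the crux BY NAME from the
registered stubs through the landed conditional closure `loopLimitZ2EqT_of_residuals` (p123663);
sorries only inside S4, S5b, S7c. -/
theorem LoopLimitZ2EqT_of : LoopLimitZ2EqT :=
  loopLimitZ2EqT_of_residuals stub_triToSquareLoops stub_influenceVanishes stub_cardyToCLE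

end Summit.CriticalPhenomena.CardyFormulaZ2.Cruxes.LoopLimitZ2EqT.HexSegment

end
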